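import Summits.ValiantsHypothesis.ValiantsHypothesis.Theorems.LacunarySymmetroidMatrixDescartesCensusM6K5GF59C1
import Summits.ValiantsHypothesis.ValiantsHypothesis.Theorems.LacunarySymmetroidMatrixDescartesCensusM6K5GF59C2
import Summits.ValiantsHypothesis.ValiantsHypothesis.Theorems.LacunarySymmetroidMatrixDescartesCensusM6K5GF59C3

/-!
# `MatrixDescartes` census certificate `M6K5GF59` (by reflection, 3 chunks): format `(m, K) = (6, 5)`, `59 ≤ Z₊` — hence `ζ_sym(6,5) ≥ 59`

HONEST FRAMING.  Generated by `reflect_row.py --chunks 3` (val-V1-extremal engine seat val-v1x-eng-10) from ONE census witness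
record; it certifies in the kernel only `¬ PosRootLawAt 6 5 58` (≥ 59 distinct positive determinant roots of the explicit
integer symmetric pencil written in the chunk files `…LacunarySymmetroidMatrixDescartesCensusM6K5GF59C1 … C3`).  Each chunk file proves, by ONE kernel computation
(`decide +kernel`, kit `…CensusReflectChunks :: chunkCheck`), that its share of the 60 rational test points is positive, strictly
increasing and carries strictly alternating exact determinant signs; consecutive chunks share their junction point; this file
glues the localised root counts (`le_card_Ioo_of_chunkCheck`, `card_filter_Ioo_add_le`) and checks symmetry (`symmB`).
Nothing is claimed about the asymptotic crux `Theses.LacunarySymmetroid.MatrixDescartes` (stmt-ValiantsHypothesis-18050)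
nor about `VP ≠ VNP`.

Source record: `C3-GAPFLAG59-6-5-0-33-34-59-173` (pub-symmetroid conjb-3 g4, gapflagm.py D-tuned gap flag on C3-TOWER4-48-6-4-0-33-34-59, 2026-08-26 (R1366); two seat codes); exponents `d = (0, 33, 34, 59, 173)`; integer entries up to
1958 digits; data sha256/16 `154057e5b5947097`; 60 points, exact `det` signs `+-+-+-+-+-+-+-+-+-+-+-+-+-+-+-+-+-+-+-+-+-+-+-+-+-+-+-+-+-+-`; chunks: 20 roots, 19 roots, 20 roots.
Context: `D(6,5) = 209`, `P(6,5) = 69`.  Generated 2026-08-28T17:28Z.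
[folklore] Descartes / intermediate value theorem; certificate by kernel reflection.
-/

-- `Summit.ValiantsHypothesis.ValiantsHypothesis.…` repeats a component by the D-0017 layout
-- (single-conjunct summit), which the `dupNamespace` linter flags; the name is mandated.
set_option linter.dupNamespace false

namespace Summit.ValiantsHypothesis.ValiantsHypothesis.Theorems.LacunarySymmetroidMatrixDescartes.Census.Reflect

open Summit.ValiantsHypothesis.ValiantsHypothesis.Theorems.MatrixDescartes.Negative (PosRootLawAt)

set_option maxHeartbeats 4000000 in
/-- **`ζ_sym(6,5) ≥ 59`** (record `C3-GAPFLAG59-6-5-0-33-34-59-173`), assembled from 3 kernel-checked chunks. [folklore] -/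
theorem gapflag59_not_posRootLawAt_6_5_58 : ¬ PosRootLawAt 6 5 58 := by
  have h1 := le_card_Ioo_of_chunkCheck gapflag59_not_posRootLawAt_6_5_58_c1
  have l1 := ptR_lt_of_chunkCheck gapflag59_not_posRootLawAt_6_5_58_c1
  have h2 := le_card_Ioo_of_chunkCheck gapflag59_not_posRootLawAt_6_5_58_c2
  have l2 := ptR_lt_of_chunkCheck gapflag59_not_posRootLawAt_6_5_58_c2
  have g2 := (Nat.add_le_add h1 h2).trans (card_filter_Ioo_add_le _ l1.le l2.le)
  have m2 := l1.trans l2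
  have h3 := le_card_Ioo_of_chunkCheck gapflag59_not_posRootLawAt_6_5_58_c3
  have l3 := ptR_lt_of_chunkCheck gapflag59_not_posRootLawAt_6_5_58_c3
  have g3 := (Nat.add_le_add g2 h3).trans (card_filter_Ioo_add_le _ m2.le l3.le)
  exact not_posRootLawAt_of_le_card_Ioo (by decide +kernel) (ptR_pos_of_chunkCheck gapflag59_not_posRootLawAt_6_5_58_c1).le g3 (by norm_num)

end Summit.ValiantsHypothesis.ValiantsHypothesis.Theorems.LacunarySymmetroidMatrixDescartes.Census.Reflect
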